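import Literature.Computability.Complexity.ShenRefereeSpec
import Literature.Computability.Complexity.CodeFPBudgets
import Literature.Computability.Complexity.CodeFPListKit
import Literature.Computability.Complexity.Transducers
import Literature.Barriers.QuantumAdvantage.TQBFCodewords
import HarnessLib

/-!
# The `IP = PSPACE` referee, machine layer I: tokenizing the matrix code and evaluating `P_φ` mod `q`
# in polynomial time

Arora–Barak's verifier finally "evaluates `g(b₁, …, bₙ)` in polynomial time" (§8.3.2; for `TQBF`,
`g = P_φ`, §8.3.3). In the tree the matrix `φ` of an instance of `TQBF` arrives as the prefix code
`PropForm.code φ` inside `encodingPropForm.encode φ = ⟨1^{size φ}, code φ⟩` (`CNF.lean`). This file turns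
that code into the typed world of `CodeFP.lean` and evaluates the arithmetization there:

* `ShenRef.Tok.code`, `tokE` — tokens as pairs of numerals (`var n ↦ (0,n)`, `const b ↦ (1,b)`,
  `¬ ↦ (2,0)`, `∧ ↦ (3,0)`, `∨ ↦ (4,0)`);
* `ShenRef.tokT` — a finite-state transducer (on the pattern of `TQBFEval.payT`, `TQBFCodewords.lean`)
  reading `PropForm.code φ` and emitting the raw list code of the tokens: **`tokT_eval_code`**
  (`tokT.eval φ.code = rawE tokE (tokens φ)`), whence **`tokensC : CodeFP pfE (rawE tokE) tokens`**;
* `ShenRef.rpnImpl` — the stack step `ShenRef.rpnStep` by case analysis on the numeric token code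
  (`rpnStep_eq_rpnImpl`), `rpnImplC`, the stack bound `rpn_stack_bound`, and
  **`natValC`**: `(q, vals, φ) ↦ natVal (max q 2) vals φ` is computed on codes (`CodeFP.foldl` over the
  reversed tokens; the modulus is used as `max q 2` so that every intermediate value is a residue on
  every input, which is what the accumulator bound of the fold needs; for the primes of the protocol
  `max p 2 = p`).

All proved; no named facts.

## References

* S. Arora, B. Barak, *Computational Complexity: A Modern Approach*, CUP 2009, §8.3.2 ("the verifier
  can evaluate `g(b₁, …, bₙ)` in polynomial time"), §8.3.3, §1.3 (polynomial time is closed under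
  composition and bounded loops), §0.1 (codes).
-/

noncomputable section

namespace Literature.Computability.Complexity

open _root_.Computability Polynomial Brick CodeFP Literature.Barriers.QuantumAdvantage

namespace ShenRef

/-! ### Token codes -/

/-- Numeric code of a token: kind and payload. [folklore] -/
def Tok.code : Tok → ℕ × ℕ
  | .var n => (0, n)
  | .cst b => (1, b.toNat)
  | .neg => (2, 0)
  | .conj => (3, 0)
  | .disj => (4, 0)

/-- The string code of a token: the pair code of its numeric code. [folklore] -/
def tokE : Tok → List Bool := fun t => pairE natE natE t.code

/-- The code of a propositional formula (`encodingPropForm`: unary size, then the prefix code). [folklore] -/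
def pfE : PropForm ℕ → List Bool := fun φ => encodingPropForm.encode φ

/-- `pfE φ = ⟨1^{size φ}, code φ⟩`. [folklore] -/
theorem pfE_apply (φ : PropForm ℕ) : pfE φ = boolPair (unaryEncodeNat φ.size) φ.code := rfl

/-- A raw list code is the concatenation of the items `⟨e a, ε⟩`. [folklore] -/
theorem rawE_eq_flatMap {α : Type} (e : α → List Bool) (l : List α) :
    rawE e l = l.flatMap fun a => boolPair (e a) [] := by
  induction l with
  | nil => rfl
  | cons a l ih => rw [rawE_cons, List.flatMap_cons, ← ih]; simp [boolPair]

/-! ### The tokenizer -/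

/-- Transition of the tokenizer (states of `TQBFEval.PS`: token boundary, after one tag bit, constant,
after `11`, copying a variable payload): on a tag it emits the item of the connective / constant, on
`00` the head `0011` of a variable item, whose doubled payload and terminator `01` are then copied.
[folklore] -/
def tokStep : TQBFEval.PS → Bool → TQBFEval.PS × List Bool
  | .tk, b => (.t1 b, [])
  | .t1 false, false => (.vk none, [false, false, true, true])
  | .t1 false, true => (.cst, [])
  | .t1 true, false => (.tk, boolPair (tokE .neg) [])
  | .t1 true, true => (.t11, [])
  | .cst, b => (.tk, boolPair (tokE (.cst b)) [])
  | .t11, false => (.tk, boolPair (tokE .conj) [])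
  | .t11, true => (.tk, boolPair (tokE .disj) [])
  | .vk none, b => (.vk (some b), [b])
  | .vk (some b), b' => (if b = b' then .vk none else .tk, [b'])

/-- **The tokenizer**: on `PropForm.code φ` it emits `rawE tokE (tokens φ)` (`tokT_eval_code`). [folklore] -/
def tokT : FST TQBFEval.PS Bool Bool where
  init := .tk
  step := tokStep
  front := fun _ => []
  keep := fun _ => true

/-- The transition of `tokT` (definitional). [folklore] -/
@[simp] theorem tokT_step (s : TQBFEval.PS) (b : Bool) : tokT.step s b = tokStep s b := rfl

/-- Copying a doubled string in the payload phase. [folklore] -/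
theorem tokT_run_vk_dbl (w rest : List Bool) :
    tokT.run (.vk none) ((w.flatMap fun b => [b, b]) ++ rest) =
      ((tokT.run (.vk none) rest).1, (w.flatMap fun b => [b, b]) ++ (tokT.run (.vk none) rest).2) := by
  induction w with
  | nil => rfl
  | cons b w ih => simp [FST.run_cons, tokStep, ih]

/-- The item of a variable token: `0011` followed by the variable's own payload `⟨bin n, ε⟩`. [folklore] -/
theorem item_var (n : ℕ) : boolPair (tokE (.var n)) [] = [false, false, true, true] ++ boolPair (encodeNat n) [] := by
  simp [tokE, Tok.code, pairE, natE, boolPair]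

/-- **The tokenizer on a formula code** (followed by anything): it emits the items of the tokens of the
formula and returns to the token boundary. [folklore] -/
theorem tokT_run_code : ∀ (φ : PropForm ℕ) (rest : List Bool),
    tokT.run .tk (φ.code ++ rest) =
      ((tokT.run .tk rest).1, ((tokens φ).flatMap fun t => boolPair (tokE t) []) ++ (tokT.run .tk rest).2)
  | .var n, rest => by
    have h : (PropForm.var n).code ++ rest =
        false :: false :: (((encodeNat n).flatMap fun b => [b, b]) ++ (false :: true :: rest)) := by
      simp [PropForm.code, boolPair]
    rw [h]
    simp [FST.run_cons, tokStep, tokT_run_vk_dbl, tokens, tokE, Tok.code, pairE, natE, boolPair]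
  | .const b, rest => by simp [PropForm.code, FST.run_cons, tokStep, tokens]
  | .neg φ, rest => by
    simp [PropForm.code, FST.run_cons, tokStep, tokT_run_code φ rest, tokens]
  | .conj φ ψ, rest => by
    simp [PropForm.code, FST.run_cons, tokStep, List.append_assoc, tokT_run_code φ (ψ.code ++ rest),
      tokT_run_code ψ rest, tokens]
  | .disj φ ψ, rest => by
    simp [PropForm.code, FST.run_cons, tokStep, List.append_assoc, tokT_run_code φ (ψ.code ++ rest),
      tokT_run_code ψ rest, tokens]

/-- **The tokenizer computes the raw list code of the tokens.** [folklore] -/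
theorem tokT_eval_code (φ : PropForm ℕ) : tokT.eval φ.code = rawE tokE (tokens φ) := by
  have h := tokT_run_code φ []
  rw [List.append_nil] at h
  simp only [FST.eval, show tokT.init = TQBFEval.PS.tk from rfl, h, FST.run_nil, List.append_nil,
    show tokT.keep = fun _ => true from rfl, show tokT.front = fun _ => [] from rfl, if_true, List.nil_append]
  rw [rawE_eq_flatMap]

/-- **Tokenizing is polynomial time on codes**: `φ ↦ tokens φ`, from the formula code to the raw list of
token codes. [cite: AroraBarakCC2009, §1.3] -/
theorem tokensC : CodeFP pfE (rawE tokE) tokens :=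
  of_fn (tokT.eval ∘ sndF) (comp_mem_FP tokT.polyTimeComputable_eval sndF_mem_FP) fun φ => by
    rw [Function.comp_apply, pfE_apply, sndF_boolPair, tokT_eval_code]

/-! ### The stack step on token codes -/

/-- Code of the context of the evaluation: modulus and point. [folklore] -/
abbrev evCtxE : ℕ × List ℕ → List Bool := pairE natE (rawE natE)

/-- `oneSub` on codes: `(q, a) ↦ (1 + q - a) % q`. [folklore] -/
theorem oneSubC : CodeFP (pairE natE natE) natE (fun t => oneSub t.1 t.2) := by
  have h1 : CodeFP (pairE natE natE) natE (fun t => 1 + t.1) := (natAdd.comp ((const _ 1).pair (fst _ _)) :)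
  have h2 : CodeFP (pairE natE natE) natE (fun t => 1 + t.1 - t.2) := (natSub.comp (h1.pair (snd _ _)) :)
  have h3 : CodeFP (pairE natE natE) natE (fun t => (1 + t.1 - t.2) % t.1) := (natMod.comp (h2.pair (fst _ _)) :)
  exact h3.congr fun t => by unfold oneSub; rfl

/-- The value pushed by `∨`: `1 - (1 - a)(1 - b)` mod `q`. [cite: AroraBarakCC2009, §8.3.1] -/
def disjVal (q a b : ℕ) : ℕ := oneSub q (oneSub q a * oneSub q b % q)

/-- `disjVal` on codes. [folklore] -/
theorem disjValC : CodeFP (pairE natE (pairE natE natE)) natE (fun t => disjVal t.1 t.2.1 t.2.2) := by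
  have hq : CodeFP (pairE natE (pairE natE natE)) natE (fun t => t.1) := fst _ _
  have ha : CodeFP (pairE natE (pairE natE natE)) natE (fun t => oneSub t.1 t.2.1) := (oneSubC.comp (hq.pair (snd _ _).fst') :)
  have hb : CodeFP (pairE natE (pairE natE natE)) natE (fun t => oneSub t.1 t.2.2) := (oneSubC.comp (hq.pair (snd _ _).snd') :)
  have h1 : CodeFP (pairE natE (pairE natE natE)) natE (fun t => oneSub t.1 t.2.1 * oneSub t.1 t.2.2) := (natMul.comp (ha.pair hb) :)
  have h2 : CodeFP (pairE natE (pairE natE natE)) natE (fun t => oneSub t.1 t.2.1 * oneSub t.1 t.2.2 % t.1) :=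
    (natMod.comp (h1.pair hq) :)
  have h3 : CodeFP (pairE natE (pairE natE natE)) natE (fun t => oneSub t.1 (oneSub t.1 t.2.1 * oneSub t.1 t.2.2 % t.1)) :=
    (oneSubC.comp (hq.pair h2) :)
  exact h3.congr fun t => rfl

/-- The stack step by case analysis on the numeric code `(kind, payload)` of the token (total in the
stack: an underflow empties it, as in `rpnStep`). [folklore] -/
def rpnImpl (q : ℕ) (vals : List ℕ) (st : List ℕ) (kind payload : ℕ) : List ℕ :=
  if kind == 0 then (vals.getD payload 0 % q) :: st
  else if kind == 1 then (payload % q) :: st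
  else if kind == 2 then (if st.isEmpty then [] else oneSub q (st.headD 0) :: st.tail)
  else if kind == 3 then
    (if st.isEmpty || st.tail.isEmpty then [] else (st.headD 0 * st.tail.headD 0 % q) :: st.tail.tail)
  else
    (if st.isEmpty || st.tail.isEmpty then [] else disjVal q (st.headD 0) (st.tail.headD 0) :: st.tail.tail)

/-- `rpnStep` is `rpnImpl` on the token code. [folklore] -/
theorem rpnStep_eq_rpnImpl (q : ℕ) (vals st : List ℕ) (t : Tok) :
    rpnStep q vals st t = rpnImpl q vals st t.code.1 t.code.2 := by
  cases t with
  | var n => rfl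
  | cst b => cases b <;> rfl
  | neg => cases st <;> rfl
  | conj =>
    rcases st with _ | ⟨a, _ | ⟨b, st⟩⟩ <;> rfl
  | disj =>
    rcases st with _ | ⟨a, _ | ⟨b, st⟩⟩ <;> rfl

/-- The tuple handed to the stack step on codes: context, token, stack. [folklore] -/
abbrev RT : Type := (ℕ × List ℕ) × Tok × List ℕ

/-- Code of the stack-step tuple. [folklore] -/
abbrev rtE : RT → List Bool := pairE evCtxE (pairE tokE (rawE natE))

/-- The modulus `max q 2`, on codes. [folklore] -/
theorem rtQ : CodeFP rtE natE (fun t : RT => max t.1.1 2) := (natMax.comp ((fst _ _).fst'.pair (const _ 2)) :)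

/-- The point, on codes. [folklore] -/
theorem rtVals : CodeFP rtE (rawE natE) (fun t : RT => t.1.2) := (fst _ _).snd'

/-- The numeric code of the token, on codes (the token code IS its pair code). [folklore] -/
theorem rtTok : CodeFP rtE (pairE natE natE) (fun t : RT => t.2.1.code) :=
  ((of_fn id (PolyTimeComputable.id _) (fun _ => rfl) : CodeFP tokE (pairE natE natE) Tok.code).comp (snd _ _).fst' :)

/-- The stack and its first two tails and heads, on codes. [folklore] -/
theorem rtSt : CodeFP rtE (rawE natE) (fun t : RT => t.2.2) := (snd _ _).snd'

/-- The tail of the stack. [folklore] -/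
theorem rtSt1 : CodeFP rtE (rawE natE) (fun t : RT => t.2.2.tail) := ((rawTail natE).comp rtSt :)

/-- The second tail of the stack. [folklore] -/
theorem rtSt2 : CodeFP rtE (rawE natE) (fun t : RT => t.2.2.tail.tail) := ((rawTail natE).comp rtSt1 :)

/-- The top of the stack. [folklore] -/
theorem rtA : CodeFP rtE natE (fun t : RT => t.2.2.headD 0) := ((rawHeadD natE (d := (0 : ℕ)) rfl).comp rtSt :)

/-- The second entry of the stack. [folklore] -/
theorem rtB : CodeFP rtE natE (fun t : RT => t.2.2.tail.headD 0) := ((rawHeadD natE (d := (0 : ℕ)) rfl).comp rtSt1 :)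

/-- Reduction mod `max q 2` of a computed number. [folklore] -/
theorem rtMod {g : RT → ℕ} (hg : CodeFP rtE natE g) : CodeFP rtE natE (fun t => g t % max t.1.1 2) :=
  (natMod.comp (hg.pair rtQ) :)

/-- `oneSub (max q 2)` of a computed number. [folklore] -/
theorem rtSub {g : RT → ℕ} (hg : CodeFP rtE natE g) : CodeFP rtE natE (fun t => oneSub (max t.1.1 2) (g t)) :=
  (oneSubC.comp (rtQ.pair hg) :)

/-- Branch `var`: push the value of the variable. [folklore] -/
theorem rtBr0 : CodeFP rtE (rawE natE) (fun t : RT => (t.1.2.getD t.2.1.code.2 0 % max t.1.1 2) :: t.2.2) := by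
  have h1 : CodeFP rtE natE (fun t : RT => t.1.2.getD t.2.1.code.2 0) := ((rawGetD natE (d := (0 : ℕ)) rfl).comp (rtVals.pair rtTok.snd') :)
  have h2 : CodeFP rtE natE (fun t : RT => t.1.2.getD t.2.1.code.2 0 % max t.1.1 2) := rtMod h1
  exact ((rawCons natE).comp (h2.pair rtSt) :)

/-- Branch `const`: push the constant. [folklore] -/
theorem rtBr1 : CodeFP rtE (rawE natE) (fun t : RT => (t.2.1.code.2 % max t.1.1 2) :: t.2.2) := by
  have h1 : CodeFP rtE natE (fun t : RT => t.2.1.code.2 % max t.1.1 2) := rtMod rtTok.snd'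
  exact ((rawCons natE).comp (h1.pair rtSt) :)

/-- Branch `¬`. [folklore] -/
theorem rtBr2 : CodeFP rtE (rawE natE)
    (fun t : RT => if t.2.2.isEmpty then [] else oneSub (max t.1.1 2) (t.2.2.headD 0) :: t.2.2.tail) := by
  have h1 : CodeFP rtE natE (fun t : RT => oneSub (max t.1.1 2) (t.2.2.headD 0)) := rtSub rtA
  have h2 : CodeFP rtE (rawE natE) (fun t : RT => oneSub (max t.1.1 2) (t.2.2.headD 0) :: t.2.2.tail) :=
    ((rawCons natE).comp (h1.pair rtSt1) :)
  have h3 : CodeFP rtE bitE (fun t : RT => t.2.2.isEmpty) := ((rawIsEmpty natE).comp rtSt :)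
  exact h3.ite (const _ []) h2

/-- The underflow test of the binary connectives. [folklore] -/
theorem rtEmp2 : CodeFP rtE bitE (fun t : RT => t.2.2.isEmpty || t.2.2.tail.isEmpty) := by
  have h1 : CodeFP rtE bitE (fun t : RT => t.2.2.isEmpty) := ((rawIsEmpty natE).comp rtSt :)
  have h2 : CodeFP rtE bitE (fun t : RT => t.2.2.tail.isEmpty) := ((rawIsEmpty natE).comp rtSt1 :)
  exact h1.or h2

/-- Branch `∧`. [folklore] -/
theorem rtBr3 : CodeFP rtE (rawE natE)
    (fun t : RT => if t.2.2.isEmpty || t.2.2.tail.isEmpty then []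
      else (t.2.2.headD 0 * t.2.2.tail.headD 0 % max t.1.1 2) :: t.2.2.tail.tail) := by
  have h1 : CodeFP rtE natE (fun t : RT => t.2.2.headD 0 * t.2.2.tail.headD 0) := (natMul.comp (rtA.pair rtB) :)
  have h2 : CodeFP rtE natE (fun t : RT => t.2.2.headD 0 * t.2.2.tail.headD 0 % max t.1.1 2) := rtMod h1
  have h3 : CodeFP rtE (rawE natE) (fun t : RT => (t.2.2.headD 0 * t.2.2.tail.headD 0 % max t.1.1 2) :: t.2.2.tail.tail) :=
    ((rawCons natE).comp (h2.pair rtSt2) :)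
  exact rtEmp2.ite (const _ []) h3

/-- Branch `∨`. [folklore] -/
theorem rtBr4 : CodeFP rtE (rawE natE)
    (fun t : RT => if t.2.2.isEmpty || t.2.2.tail.isEmpty then []
      else disjVal (max t.1.1 2) (t.2.2.headD 0) (t.2.2.tail.headD 0) :: t.2.2.tail.tail) := by
  have h1 : CodeFP rtE natE (fun t : RT => disjVal (max t.1.1 2) (t.2.2.headD 0) (t.2.2.tail.headD 0)) :=
    (disjValC.comp (rtQ.pair (rtA.pair rtB)) :)
  have h2 : CodeFP rtE (rawE natE) (fun t : RT => disjVal (max t.1.1 2) (t.2.2.headD 0) (t.2.2.tail.headD 0) :: t.2.2.tail.tail) :=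
    ((rawCons natE).comp (h1.pair rtSt2) :)
  exact rtEmp2.ite (const _ []) h2

/-- The kind test. [folklore] -/
theorem rtKind (c : ℕ) : CodeFP rtE bitE (fun t : RT => t.2.1.code.1 == c) :=
  ((beq natE_injective).comp (rtTok.fst'.pair (const _ c)) :)

/-- **The stack step on codes**: `((q, vals), (token, stack)) ↦ rpnStep (max q 2) vals stack token`.
[cite: AroraBarakCC2009, §1.3] -/
theorem rpnImplC : CodeFP (pairE evCtxE (pairE tokE (rawE natE))) (rawE natE)
    (fun t => rpnStep (max t.1.1 2) t.1.2 t.2.2 t.2.1) := by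
  have hall := (rtKind 0).ite rtBr0 ((rtKind 1).ite rtBr1 ((rtKind 2).ite rtBr2 ((rtKind 3).ite rtBr3 rtBr4)))
  refine hall.congr fun t => ?_
  rw [rpnStep_eq_rpnImpl]
  rfl

/-! ### The evaluation fold -/

/-- Each stack step grows the stack by at most one entry. [folklore] -/
theorem length_rpnStep_le (q : ℕ) (vals st : List ℕ) (t : Tok) : (rpnStep q vals st t).length ≤ st.length + 1 := by
  cases t with
  | var n => simp [rpnStep]
  | cst b => simp [rpnStep]
  | neg => cases st <;> simp [rpnStep]
  | conj => rcases st with _ | ⟨a, _ | ⟨b, st⟩⟩ <;> simp [rpnStep]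
  | disj => rcases st with _ | ⟨a, _ | ⟨b, st⟩⟩ <;> simp [rpnStep]

/-- With a positive modulus every stack entry is a residue, provided the old ones were. [folklore] -/
theorem forall_lt_rpnStep {q : ℕ} (hq : 0 < q) (vals : List ℕ) {st : List ℕ} (hst : ∀ x ∈ st, x < q) (t : Tok) :
    ∀ x ∈ rpnStep q vals st t, x < q := by
  cases t with
  | var n => simp only [rpnStep, List.mem_cons]; rintro x (rfl | hx); exacts [Nat.mod_lt _ hq, hst x hx]
  | cst b => simp only [rpnStep, List.mem_cons]; rintro x (rfl | hx); exacts [Nat.mod_lt _ hq, hst x hx]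
  | neg =>
    cases st with
    | nil => simp [rpnStep]
    | cons a st =>
      simp only [rpnStep, List.mem_cons]; rintro x (rfl | hx)
      exacts [Nat.mod_lt _ hq, hst x (List.mem_cons_of_mem _ hx)]
  | conj =>
    rcases st with _ | ⟨a, _ | ⟨b, st⟩⟩
    · simp [rpnStep]
    · simp [rpnStep]
    · simp only [rpnStep, List.mem_cons]; rintro x (rfl | hx)
      exacts [Nat.mod_lt _ hq, hst x (List.mem_cons_of_mem _ (List.mem_cons_of_mem _ hx))]
  | disj =>
    rcases st with _ | ⟨a, _ | ⟨b, st⟩⟩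
    · simp [rpnStep]
    · simp [rpnStep]
    · simp only [rpnStep, List.mem_cons]; rintro x (rfl | hx)
      exacts [Nat.mod_lt _ hq, hst x (List.mem_cons_of_mem _ (List.mem_cons_of_mem _ hx))]

/-- **The stack stays short and small** along the fold: at most `|l|` residues mod `q`. [folklore] -/
theorem rpn_stack_bound {q : ℕ} (hq : 0 < q) (vals : List ℕ) (l : List Tok) :
    (l.foldl (rpnStep q vals) []).length ≤ l.length ∧ ∀ x ∈ l.foldl (rpnStep q vals) [], x < q := by
  suffices h : ∀ st : List ℕ, (∀ x ∈ st, x < q) →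
      (l.foldl (rpnStep q vals) st).length ≤ st.length + l.length ∧ ∀ x ∈ l.foldl (rpnStep q vals) st, x < q by
    simpa using h [] (by simp)
  induction l with
  | nil => intro st hst; simpa using hst
  | cons t l ih =>
    intro st hst
    rw [List.foldl_cons]
    obtain ⟨h1, h2⟩ := ih _ (forall_lt_rpnStep hq vals hst t)
    refine ⟨h1.trans ?_, h2⟩
    have := length_rpnStep_le q vals st t
    rw [List.length_cons]; omega

/-- The raw code of a list of residues mod `q` of length `≤ n` has length `≤ n · (2 |bin q| + 2)`. [folklore] -/
theorem length_rawE_natE_le_of_lt {q n : ℕ} {L : List ℕ} (hlen : L.length ≤ n) (hlt : ∀ x ∈ L, x < q) :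
    (rawE natE L).length ≤ n * (2 * (natE q).length + 2) := by
  rw [length_rawE]
  calc (L.map fun a => 2 * (natE a).length + 2).sum ≤ L.length * (2 * (natE q).length + 2) := by
        refine (List.sum_le_card_nsmul _ _ fun x hx => ?_).trans (by rw [List.length_map, smul_eq_mul])
        obtain ⟨a, ha, rfl⟩ := List.mem_map.1 hx
        have : (natE a).length ≤ (natE q).length := by
          rw [length_natE, length_natE]; exact size_mono (hlt a ha).le
        omega
    _ ≤ n * (2 * (natE q).length + 2) := Nat.mul_le_mul_right _ hlen

/-- **Evaluating `P_φ` mod `max q 2` on codes**: `((q, vals), φ) ↦ natVal (max q 2) vals φ` — tokenize,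
reverse, run the stack machine, read the top of the stack. [cite: AroraBarakCC2009, §8.3.2 ("the verifier can evaluate `g(b₁, …, bₙ)` in polynomial time")] -/
theorem natValC : CodeFP (pairE evCtxE pfE) natE (fun t => natVal (max t.1.1 2) t.1.2 t.2) := by
  -- the fold over an arbitrary token list
  have hfold : CodeFP (pairE evCtxE (rawE tokE)) (rawE natE)
      (fun p => p.2.foldl (fun st t => rpnStep (max p.1.1 2) p.1.2 st t) []) := by
    refine foldl (σ := ℕ × List ℕ) (α := Tok) (β := List ℕ) (eσ := evCtxE) (eα := tokE) (eβ := rawE natE)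
      (step := fun s t st => rpnStep (max s.1 2) s.2 st t) (init := fun _ => []) rpnImplC (const _ [])
      (X * (2 * X + 2)) fun s l₁ l₂ => ?_
    have hq : 0 < max s.1 2 := lt_max_of_lt_right zero_lt_two
    obtain ⟨hlen, hlt⟩ := rpn_stack_bound hq s.2 l₁
    set W := (pairE evCtxE (rawE tokE) (s, l₁ ++ l₂)).length with hW
    have hW' : W = 2 * (2 * (natE s.1).length + 2 + (rawE natE s.2).length) + 2 + (rawE tokE (l₁ ++ l₂)).length := by
      simp [hW, pairE]
    have hl₁ : l₁.length ≤ W := by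
      have h1 := length_le_length_rawE tokE (l₁ ++ l₂)
      rw [List.length_append] at h1; omega
    have hq2 : (natE (max s.1 2)).length ≤ (natE s.1).length + 2 := by
      rw [length_natE, length_natE]
      rcases le_or_gt s.1 2 with h | h
      · rw [max_eq_right h]; exact (Nat.size_le.2 (by norm_num)).trans (Nat.le_add_left _ _)
      · rw [max_eq_left h.le]; omega
    have hqW : 2 * (natE (max s.1 2)).length + 2 ≤ 2 * W + 2 := by omega
    calc (rawE natE (l₁.foldl (fun st t => rpnStep (max s.1 2) s.2 st t) [])).length
        ≤ l₁.length * (2 * (natE (max s.1 2)).length + 2) := length_rawE_natE_le_of_lt hlen hlt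
      _ ≤ W * (2 * W + 2) := Nat.mul_le_mul hl₁ hqW
      _ = (X * (2 * X + 2) : Polynomial ℕ).eval W := by simp
  -- tokenize, reverse, fold, head
  have htoks : CodeFP (pairE evCtxE pfE) (rawE tokE) (fun t => (tokens t.2).reverse) :=
    ((rawReverse tokE).comp (tokensC.comp (snd _ _)) :)
  have hrun : CodeFP (pairE evCtxE pfE) (rawE natE)
      (fun t => (tokens t.2).reverse.foldl (fun st tk => rpnStep (max t.1.1 2) t.1.2 st tk) []) :=
    (hfold.comp ((fst _ _).pair htoks) :)
  refine ((rawHeadD natE (d := (0 : ℕ)) rfl).comp hrun).congr fun t => ?_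
  have h := foldl_rpnStep_reverse_tokens (max t.1.1 2) t.1.2 t.2 [] []
  rw [List.append_nil] at h
  simp only [h, List.foldl_nil, List.headD_cons]

end ShenRef

end Literature.Computability.Complexity

end
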